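import Summits.Langlands.Langlands.Theses.EisensteinGelfandKirillov
import Summits.Langlands.Langlands.Theorems.IrreducibilityBySelfDualityIrreducibleOffSectorIotaTransport
import Literature.NumberTheory.GaloisRepresentations.GaloisRepFrobeniusProofs
import HarnessLib

/-!
# Route EisensteinGelfandKirillov — `SectorComplement` (stmt-Langlands-18275): the EISENSTEIN ENTRY
(line `Sketch-18275-r1-k1`, idea `eisenstein-entry`; `--supports` file; no definitions)

The crux `SectorComplement := ReducibleCrystallineModular → Langlands` is the route's frame item. Its
antecedent `X := ReducibleCrystallineModular` (Fontaine–Mazur in the residually upper-triangular,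
`p`-distinguished, crystalline Hodge–Tate-regular `GL₂` sector `Σ_X` over totally real `K`, `p ≥ 5`
unramified in `K`, ordinarity NOT assumed) does work OUTSIDE its own sector along compatible families:
Satake–Frobenius compatibility of a cuspidal `π` with one member of a family of Galois representations
moves to every COMPANION (same complex Frobenius polynomials at almost all places) by pure polynomial
algebra — uniqueness of Frobenius polynomials and injectivity of `Polynomial.map ι⁻¹` — with no
Chebotarev, no irreducibility and no hypothesis on the companion.  Entering the family through its
residually REDUCIBLE member (where residual automorphy is free and `X` lifts) gives:

* `eventually_satakeFrobCompatibleAt_of_companion` — companion transport, every rank `n`;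
* `eisensteinEntry_of_reducibleCrystallineModular` — **X ⇒ weak automorphy of every rank-2 companion of
  a `Σ_X` member**: any prime `ℓ`, any `ι`, any residual image, any behaviour at `ℓ` (the hypotheses on
  the `p`-adic member are VERBATIM the binders of the route target);
* `weakAutomorphy_of_reducibleCrystallineModular_of_off` — the CUT of the summit leaf B_w
  (Fontaine–Mazur–Langlands, a.e. form, all `n`, all `K`; text of the registered stub of
  stmt-Langlands-14328 `stub_fontaineMazurLanglandsGLn` unfolded) along the Eisenstein region:
  `X` + "B_w off the region" (text of this line's registered stub `stub_weakAutomorphyOffEisenstein`) ⇒ B_w.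

These are the proved, `X`-consuming steps of the line's registered skeleton
(`Cruxes/SectorComplement/Lines/Sketch_18275_r1_k1.lean`, `SectorComplement_of`).

References: J.-P. Serre, *Abelian ℓ-adic representations and elliptic curves* (1968), Ch. I §2.3
[SerreAbelianLadic1968]; C. Skinner, A. Wiles, Publ. IHÉS 89 (1999), Thm. A [SkinnerWiles1999];
J.-M. Fontaine, B. Mazur (1995), Conj. 1 [FontaineMazurGeometric1995].
-/

noncomputable section

set_option linter.dupNamespace false -- project-wide option; `Summit.Langlands.Langlands` is the mandated namespace

open scoped NumberField Classical Polynomial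
open Filter IsDedekindDomain Polynomial
open Literature.NumberTheory.Automorphic Literature.NumberTheory.GaloisRepresentations
open Summit.Langlands
open Summit.Langlands.Langlands.Theses.EisensteinGelfandKirillov (ReducibleCrystallineModular)

namespace Summit.Langlands.Langlands.Theorems.EisensteinEntry

/-- **Companion transport of Satake–Frobenius compatibility** (any rank `n`, any two primes `ℓ, p`).
If `π` on `GL_n(𝔸_K)` is Satake–Frobenius compatible a.e. with `ρ_p` through `ι_p`, and `ρ` is a
COMPANION of `ρ_p` — a.e. `ρ` is unramified and some complex polynomial is the Frobenius polynomial
of `ρ` read through `ι` and of `ρ_p` read through `ι_p` — then `π` is Satake–Frobenius compatible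
a.e. with `ρ` through `ι`.  Proof: the common polynomial IS the Satake polynomial `∏ (X - α_j⁻¹)`
(uniqueness of Frobenius polynomials, `GaloisRep.HasFrobCharpolyAt.unique_holds`, and injectivity of
`Polynomial.map ι_p⁻¹`), then read it through `ι` (`arithFrobPolyOfSatake_one_eq_map`).
[cite: SerreAbelianLadic1968, Ch. I §2.3] -/
theorem eventually_satakeFrobCompatibleAt_of_companion {K : Type} [Field K] [NumberField K] {n : ℕ}
    {hcpt : isCompact_glFiniteIntegralLevel n K} {ℓ p : ℕ} [Fact ℓ.Prime] [Fact p.Prime]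
    (ι : PadicAlgCl ℓ ≃+* ℂ) (ιp : PadicAlgCl p ≃+* ℂ) (π : AutomorphicRepData (AutomorphyDatum.gl n K hcpt))
    (ρ : FramedGaloisRep K (PadicAlgCl ℓ) n) (ρp : FramedGaloisRep K (PadicAlgCl p) n)
    (hπ : ∀ᶠ v : HeightOneSpectrum (𝓞 K) in cofinite, SatakeFrobCompatibleAt ιp π ρp v)
    (hcomp : ∀ᶠ v : HeightOneSpectrum (𝓞 K) in cofinite, ρ.IsUnramifiedAt v ∧
      ∃ P : Polynomial ℂ, ρ.HasFrobCharpolyAt v (P.map (ι.symm : ℂ →+* PadicAlgCl ℓ)) ∧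
        ρp.HasFrobCharpolyAt v (P.map (ιp.symm : ℂ →+* PadicAlgCl p))) :
    ∀ᶠ v : HeightOneSpectrum (𝓞 K) in cofinite, SatakeFrobCompatibleAt ι π ρ v := by
  filter_upwards [hπ, hcomp] with v hv hv'
  obtain ⟨α, hα, -, hcp⟩ := hv
  obtain ⟨hurρ, P, hPρ, hPp⟩ := hv'
  have h1 : P.map (ιp.symm : ℂ →+* PadicAlgCl p) = arithFrobPolyOfSatake ιp v.residueCard 1 α :=
    GaloisRep.HasFrobCharpolyAt.unique_holds
      ((FramedGaloisRep.hasFrobCharpolyAt_toGaloisRep_iff v _ ρp).mpr hPp)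
      ((FramedGaloisRep.hasFrobCharpolyAt_toGaloisRep_iff v _ ρp).mpr hcp)
  rw [Summit.Langlands.Langlands.Theorems.IrreducibleOffSector.arithFrobPolyOfSatake_one_eq_map] at h1
  obtain rfl := Polynomial.map_injective _ ιp.symm.injective h1
  refine ⟨α, hα, hurρ, ?_⟩
  rwa [Summit.Langlands.Langlands.Theorems.IrreducibleOffSector.arithFrobPolyOfSatake_one_eq_map]

/-- Companionship is symmetric in the two representations (the common polynomial is shared); recorded
in the unramified-on-both-sides form used downstream. [folklore] -/
theorem companion_symm {K : Type} [Field K] [NumberField K] {n m : ℕ} {ℓ p : ℕ} [Fact ℓ.Prime]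
    [Fact p.Prime] (ι : PadicAlgCl ℓ ≃+* ℂ) (ιp : PadicAlgCl p ≃+* ℂ)
    (ρ : FramedGaloisRep K (PadicAlgCl ℓ) n) (ρp : FramedGaloisRep K (PadicAlgCl p) m)
    (hcomp : ∀ᶠ v : HeightOneSpectrum (𝓞 K) in cofinite, (ρ.IsUnramifiedAt v ∧ ρp.IsUnramifiedAt v) ∧
      ∃ P : Polynomial ℂ, ρ.HasFrobCharpolyAt v (P.map (ι.symm : ℂ →+* PadicAlgCl ℓ)) ∧
        ρp.HasFrobCharpolyAt v (P.map (ιp.symm : ℂ →+* PadicAlgCl p))) :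
    ∀ᶠ v : HeightOneSpectrum (𝓞 K) in cofinite, (ρp.IsUnramifiedAt v ∧ ρ.IsUnramifiedAt v) ∧
      ∃ P : Polynomial ℂ, ρp.HasFrobCharpolyAt v (P.map (ιp.symm : ℂ →+* PadicAlgCl p)) ∧
        ρ.HasFrobCharpolyAt v (P.map (ι.symm : ℂ →+* PadicAlgCl ℓ)) :=
  hcomp.mono fun _ ⟨⟨h1, h2⟩, P, hP, hP'⟩ => ⟨⟨h2, h1⟩, P, hP', hP⟩

/-- **The Eisenstein entry: `X` ⇒ weak automorphy of every rank-2 companion of a `Σ_X` member.**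
Let `ρ_p : Γ_K → GL₂(ℚ̄_p)` satisfy VERBATIM the hypotheses of the route target
`ReducibleCrystallineModular` (`K` totally real, `p ≥ 5`, `p ∤ disc K`, `ρ_p` irreducible, totally
odd, unramified a.e., with an upper-triangular integral model over the valuation ring of `ℚ̄_p` that
is `p`-distinguished at every `v ∣ p`, crystalline for Fontaine's pinned datum with pairwise distinct
labelled Hodge–Tate weights at every `v ∣ p`), and let `ρ : Γ_K → GL₂(ℚ̄_ℓ)` (ANY prime `ℓ`, any
`ι`, no hypothesis on `ρ`: any residual image, any behaviour at `ℓ`) be a companion of `ρ_p`.  Then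
`X` gives an L-algebraic cuspidal `π` of `GL₂(𝔸_K)` Satake–Frobenius compatible with `ρ` a.e.: apply
`X` to `ρ_p` and transport along the common Frobenius polynomials.
[cite: SkinnerWiles1999, Thm. A] [cite: SerreAbelianLadic1968, Ch. I §2.3] -/
theorem eisensteinEntry_of_reducibleCrystallineModular (hX : ReducibleCrystallineModular)
    (K : Type) [Field K] [NumberField K] (hK : NumberField.IsTotallyReal K) (p : ℕ) [Fact p.Prime]
    (h5 : 5 ≤ p) (hdisc : ¬ ((p : ℤ) ∣ NumberField.discr K)) (O : ValuationSubring (PadicAlgCl p))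
    (hO : O = (Valued.v : Valuation (PadicAlgCl p) NNReal).valuationSubring)
    (hcpt : isCompact_glFiniteIntegralLevel 2 K) (ιp : PadicAlgCl p ≃+* ℂ)
    (ρp : FramedGaloisRep K (PadicAlgCl p) 2)
    (ρ₀ : Field.absoluteGaloisGroup K →* Matrix.GeneralLinearGroup (Fin 2) O)
    (hirr : ρp.toGaloisRep.IsIrreducible) (hodd : ρp.IsOdd)
    (hur : ∀ᶠ v : HeightOneSpectrum (𝓞 K) in cofinite, ρp.IsUnramifiedAt v)
    (hup : ρp.HasUpperTriangularIntegralModel ρ₀)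
    (hloc : ∀ (v : HeightOneSpectrum (𝓞 K)) (hv : ((p : ℕ) : 𝓞 K) ∈ v.asIdeal),
      IsPDistinguishedAt ρ₀ v ∧
        (Literature.NumberTheory.PAdicHodge.fontainePstAdicCompletion v p hv).IsCrystallineFramed
          (ρp.toLocal v) ∧
        (letI := (Literature.NumberTheory.PAdicHodge.fontainePstAdicCompletion v p hv).algebra
         GaloisRep.IsLabelledHodgeTateRegular
          (Literature.NumberTheory.PAdicHodge.fontainePstAdicCompletion v p hv).𝔅
          (ρp.toLocal v).toGaloisRep))
    (ℓ : ℕ) [Fact ℓ.Prime] (ι : PadicAlgCl ℓ ≃+* ℂ) (ρ : FramedGaloisRep K (PadicAlgCl ℓ) 2)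
    (hcomp : ∀ᶠ v : HeightOneSpectrum (𝓞 K) in cofinite, ρ.IsUnramifiedAt v ∧
      ∃ P : Polynomial ℂ, ρ.HasFrobCharpolyAt v (P.map (ι.symm : ℂ →+* PadicAlgCl ℓ)) ∧
        ρp.HasFrobCharpolyAt v (P.map (ιp.symm : ℂ →+* PadicAlgCl p))) :
    ∃ π : CuspidalAutomorphicRepData 2 K hcpt, π.1.IsLAlgebraic ∧
      ∀ᶠ v : HeightOneSpectrum (𝓞 K) in cofinite, SatakeFrobCompatibleAt ι π.1 ρ v := by
  obtain ⟨π, hL, hπ⟩ := hX K hK p h5 hdisc O hO hcpt ιp ρp ρ₀ hirr hodd hur hup hloc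
  exact ⟨π, hL, eventually_satakeFrobCompatibleAt_of_companion ι ιp π.1 ρ ρp hπ hcomp⟩

/-- **`X` discharges B_w on the whole Eisenstein region `R(X)`** — the line's first lemma as ONE
proposition (the registered sub-goal `eisensteinRegionAutomorphy_of_reducibleCrystallineModular` of
crux stmt-Langlands-18275): for every number field `K`, prime `ℓ`, `ι`, and rank-2 `ρ` having a
companion `ρ_p` in the sector `Σ_X` at SOME prime `p` (the sector written out: the binders of the route
target verbatim), `X` yields an L-algebraic cuspidal `π` of `GL₂(𝔸_K)` Satake–Frobenius compatible with
`ρ` a.e.  [cite: SkinnerWiles1999, Thm. A] [cite: SerreAbelianLadic1968, Ch. I §2.3] -/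
theorem eisensteinRegionAutomorphy_of_reducibleCrystallineModular : Summit.Langlands.Langlands.Theses.EisensteinGelfandKirillov.ReducibleCrystallineModular → ∀ (K : Type) [Field K] [NumberField K] (hcpt : Literature.NumberTheory.Automorphic.isCompact_glFiniteIntegralLevel 2 K) (ℓ : ℕ) [Fact ℓ.Prime] (ι : PadicAlgCl ℓ ≃+* ℂ) (ρ : Literature.NumberTheory.GaloisRepresentations.FramedGaloisRep K (PadicAlgCl ℓ) 2), (∃ (p : ℕ) (_ : Fact p.Prime) (ιp : PadicAlgCl p ≃+* ℂ) (ρp : Literature.NumberTheory.GaloisRepresentations.FramedGaloisRep K (PadicAlgCl p) 2), (NumberField.IsTotallyReal K ∧ 5 ≤ p ∧ ¬ ((p : ℤ) ∣ NumberField.discr K) ∧ ρp.toGaloisRep.IsIrreducible ∧ ρp.IsOdd ∧ (∀ᶠ v : IsDedekindDomain.HeightOneSpectrum (NumberField.RingOfIntegers K) in cofinite, ρp.IsUnramifiedAt v) ∧ ∃ (O : ValuationSubring (PadicAlgCl p)) (_ : O = (Valued.v : Valuation (PadicAlgCl p) NNReal).valuationSubring) (ρ₀ : Field.absoluteGaloisGroup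 K →* Matrix.GeneralLinearGroup (Fin 2) O), ρp.HasUpperTriangularIntegralModel ρ₀ ∧ ∀ (v : IsDedekindDomain.HeightOneSpectrum (NumberField.RingOfIntegers K)) (hv : ((p : ℕ) : NumberField.RingOfIntegers K) ∈ v.asIdeal), Literature.NumberTheory.GaloisRepresentations.IsPDistinguishedAt ρ₀ v ∧ (Literature.NumberTheory.PAdicHodge.fontainePstAdicCompletion v p hv).IsCrystallineFramed (ρp.toLocal v) ∧ (letI := (Literature.NumberTheory.PAdicHodge.fontainePstAdicCompletion v p hv).algebra; Literature.NumberTheory.GaloisRepresentations.GaloisRep.IsLabelledHodgeTateRegular (Literature.NumberTheory.PAdicHodge.fontainePstAdicCompletion v p hv).𝔅 (ρp.toLocal v).toGaloisRep)) ∧ ∀ᶠ v : IsDedekindDomain.HeightOneSpectrum (NumberField.RingOfIntegers K) in cofinite, ρ.IsUnramifiedAt v ∧ ∃ P : Polynomial ℂ, ρ.HasFrobCharpolyAt v (P.map (ι.symm : ℂ →+* PadicAlgCl ℓ)) ∧ ρp.HasFrobCharpolyAt v (P.map (ιp.symm : ℂ →+* PadicAlgCl p))) → ∃ π : Literature.NumberTheory.Automorphic.CuspidalAutomorphicRepData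 2 K hcpt, π.1.IsLAlgebraic ∧ ∀ᶠ v : IsDedekindDomain.HeightOneSpectrum (NumberField.RingOfIntegers K) in cofinite, Summit.Langlands.SatakeFrobCompatibleAt ι π.1 ρ v := by
  intro hX K _ _ hcpt ℓ _ ι ρ hreg
  obtain ⟨p, hp, ιp, ρp, ⟨hK, h5, hdisc, hirrp, hodd, hur, O, hO, ρ₀, hup, hloc⟩, hcomp⟩ := hreg
  exact eisensteinEntry_of_reducibleCrystallineModular hX K hK p h5 hdisc O hO hcpt ιp ρp ρ₀ hirrp hodd
    hur hup hloc ℓ ι ρ hcomp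

/-- **The cut of B_w along the Eisenstein region.**  B_w = Fontaine–Mazur–Langlands in a.e. form (every
irreducible `ρ : Γ_K → GL_n(ℚ̄_ℓ)` unramified a.e. and de Rham above `ℓ` for the pinned datum has an
L-algebraic cuspidal `π` Satake–Frobenius compatible a.e.; all `n`, all `K`) follows from `X` and
"B_w OFF the Eisenstein region" (the text of this line's registered stub
`stub_weakAutomorphyOffEisenstein`: the same conclusion for every `ρ` that is NOT a rank-2 companion of
a `Σ_X` member): case split on the region, `X` discharging it through the Eisenstein entry.
[cite: FontaineMazurGeometric1995, Conj. 1] [cite: SkinnerWiles1999, Thm. A] -/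
theorem weakAutomorphy_of_reducibleCrystallineModular_of_off (hX : ReducibleCrystallineModular)
    (hoff : ∀ (K : Type) [Field K] [NumberField K] (n : ℕ) (hcpt : Literature.NumberTheory.Automorphic.isCompact_glFiniteIntegralLevel n K), 0 < n → ∀ (ℓ : ℕ) [Fact ℓ.Prime] (ι : PadicAlgCl ℓ ≃+* ℂ) (ρ : Literature.NumberTheory.GaloisRepresentations.FramedGaloisRep K (PadicAlgCl ℓ) n), ρ.toGaloisRep.IsIrreducible → ((∀ᶠ v : IsDedekindDomain.HeightOneSpectrum (NumberField.RingOfIntegers K) in cofinite, ρ.IsUnramifiedAt v) ∧ ∀ (v : IsDedekindDomain.HeightOneSpectrum (NumberField.RingOfIntegers K)) (hv : ((ℓ : ℕ) : NumberField.RingOfIntegers K) ∈ v.asIdeal), (Literature.NumberTheory.PAdicHodge.fontainePstAdicCompletion v ℓ hv).IsDeRhamFramed (ρ.toLocal v)) → ¬ (n = 2 ∧ ∃ (p : ℕ) (_ : Fact p.Prime) (ιp : PadicAlgCl p ≃+* ℂ) (ρp : Literature.NumberTheory.GaloisRepresentations.FramedGaloisRep K (PadicAlgCl p) 2), (NumberField.IsTotallyReal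 K ∧ 5 ≤ p ∧ ¬ ((p : ℤ) ∣ NumberField.discr K) ∧ ρp.toGaloisRep.IsIrreducible ∧ ρp.IsOdd ∧ (∀ᶠ v : IsDedekindDomain.HeightOneSpectrum (NumberField.RingOfIntegers K) in cofinite, ρp.IsUnramifiedAt v) ∧ ∃ (O : ValuationSubring (PadicAlgCl p)) (_ : O = (Valued.v : Valuation (PadicAlgCl p) NNReal).valuationSubring) (ρ₀ : Field.absoluteGaloisGroup K →* Matrix.GeneralLinearGroup (Fin 2) O), ρp.HasUpperTriangularIntegralModel ρ₀ ∧ ∀ (v : IsDedekindDomain.HeightOneSpectrum (NumberField.RingOfIntegers K)) (hv : ((p : ℕ) : NumberField.RingOfIntegers K) ∈ v.asIdeal), Literature.NumberTheory.GaloisRepresentations.IsPDistinguishedAt ρ₀ v ∧ (Literature.NumberTheory.PAdicHodge.fontainePstAdicCompletion v p hv).IsCrystallineFramed (ρp.toLocal v) ∧ (letI := (Literature.NumberTheory.PAdicHodge.fontainePstAdicCompletion v p hv).algebra; Literature.NumberTheory.GaloisRepresentations.GaloisRep.IsLabelledHodgeTateRegular (Literature.NumberTheory.PAdicHodge.fontainePstAdicCompletion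 v p hv).𝔅 (ρp.toLocal v).toGaloisRep)) ∧ ∀ᶠ v : IsDedekindDomain.HeightOneSpectrum (NumberField.RingOfIntegers K) in cofinite, ρ.IsUnramifiedAt v ∧ ∃ P : Polynomial ℂ, ρ.HasFrobCharpolyAt v (P.map (ι.symm : ℂ →+* PadicAlgCl ℓ)) ∧ ρp.HasFrobCharpolyAt v (P.map (ιp.symm : ℂ →+* PadicAlgCl p))) → ∃ π : Literature.NumberTheory.Automorphic.CuspidalAutomorphicRepData n K hcpt, π.1.IsLAlgebraic ∧ ∀ᶠ v : IsDedekindDomain.HeightOneSpectrum (NumberField.RingOfIntegers K) in cofinite, SatakeFrobCompatibleAt ι π.1 ρ v) :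
    ∀ (K : Type) [Field K] [NumberField K] (n : ℕ) (hcpt : isCompact_glFiniteIntegralLevel n K),
      0 < n → ∀ (ℓ : ℕ) [Fact ℓ.Prime] (ι : PadicAlgCl ℓ ≃+* ℂ) (ρ : FramedGaloisRep K (PadicAlgCl ℓ) n),
        ρ.toGaloisRep.IsIrreducible →
          ((∀ᶠ v : HeightOneSpectrum (𝓞 K) in cofinite, ρ.IsUnramifiedAt v) ∧
            ∀ (v : HeightOneSpectrum (𝓞 K)) (hv : ((ℓ : ℕ) : 𝓞 K) ∈ v.asIdeal),
              (Literature.NumberTheory.PAdicHodge.fontainePstAdicCompletion v ℓ hv).IsDeRhamFramed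
                (ρ.toLocal v)) →
          ∃ π : CuspidalAutomorphicRepData n K hcpt, π.1.IsLAlgebraic ∧
            ∀ᶠ v : HeightOneSpectrum (𝓞 K) in cofinite, SatakeFrobCompatibleAt ι π.1 ρ v := by
  intro K _ _ n hcpt hn ℓ _ ι ρ hirr hgeo
  by_cases hreg : n = 2 ∧ ∃ (p : ℕ) (_ : Fact p.Prime) (ιp : PadicAlgCl p ≃+* ℂ) (ρp : Literature.NumberTheory.GaloisRepresentations.FramedGaloisRep K (PadicAlgCl p) 2), (NumberField.IsTotallyReal K ∧ 5 ≤ p ∧ ¬ ((p : ℤ) ∣ NumberField.discr K) ∧ ρp.toGaloisRep.IsIrreducible ∧ ρp.IsOdd ∧ (∀ᶠ v : IsDedekindDomain.HeightOneSpectrum (NumberField.RingOfIntegers K) in cofinite, ρp.IsUnramifiedAt v) ∧ ∃ (O : ValuationSubring (PadicAlgCl p)) (_ : O = (Valued.v : Valuation (PadicAlgCl p) NNReal).valuationSubring) (ρ₀ : Field.absoluteGaloisGroup K →* Matrix.GeneralLinearGroup (Fin 2) O), ρp.HasUpperTriangularIntegralModel ρ₀ ∧ ∀ (v : IsDedekindDomain.HeightOneSpectrum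 (NumberField.RingOfIntegers K)) (hv : ((p : ℕ) : NumberField.RingOfIntegers K) ∈ v.asIdeal), Literature.NumberTheory.GaloisRepresentations.IsPDistinguishedAt ρ₀ v ∧ (Literature.NumberTheory.PAdicHodge.fontainePstAdicCompletion v p hv).IsCrystallineFramed (ρp.toLocal v) ∧ (letI := (Literature.NumberTheory.PAdicHodge.fontainePstAdicCompletion v p hv).algebra; Literature.NumberTheory.GaloisRepresentations.GaloisRep.IsLabelledHodgeTateRegular (Literature.NumberTheory.PAdicHodge.fontainePstAdicCompletion v p hv).𝔅 (ρp.toLocal v).toGaloisRep)) ∧ ∀ᶠ v : IsDedekindDomain.HeightOneSpectrum (NumberField.RingOfIntegers K) in cofinite, ρ.IsUnramifiedAt v ∧ ∃ P : Polynomial ℂ, ρ.HasFrobCharpolyAt v (P.map (ι.symm : ℂ →+* PadicAlgCl ℓ)) ∧ ρp.HasFrobCharpolyAt v (P.map (ιp.symm : ℂ →+* PadicAlgCl p))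
  · obtain ⟨rfl, p, hp, ιp, ρp, ⟨hK, h5, hdisc, hirrp, hodd, hur, O, hO, ρ₀, hup, hloc⟩, hcomp⟩ := hreg
    exact eisensteinEntry_of_reducibleCrystallineModular hX K hK p h5 hdisc O hO hcpt ιp ρp ρ₀ hirrp
      hodd hur hup hloc ℓ ι ρ hcomp
  · exact hoff K n hcpt hn ℓ ι ρ hirr hgeo hreg

end Summit.Langlands.Langlands.Theorems.EisensteinEntry

end
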